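import Summits.ResolutionOfSingularities.ResolutionOfSingularities.Theorems.FrobeniusClosingDefs
import Literature.AlgebraicGeometry.Resolution.CobordantChartCoefficients
import Summits.ResolutionOfSingularities.ResolutionOfSingularities.Theorems.FrobeniusClosingClosingReductionFactorization

/-!
# Crux `ClosingReduction` — line `chart-factorization`, stub `stub_transport` (lead), part 1:
# THE DICTIONARY between the route's coefficient calculus and the chart substitution

For `f ∈ K⟦u₁,…,uₙ⟧` with coefficient function `g` (for the route: `f = ser p n K c`, `g = clean p n K c`,
definitionally), the route's move
"blow up the closed point, chart `i`, divide by `u_i ^ s`, translate to `u_j = τ_j`" is the triple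
`tr i τ s ∘ dv i s ∘ bl i` of `Theorems/FrobeniusClosingDefs.lean`; the chart substitution is
`chartMap n K i τ f = f(u_i(u₁+τ₁), …, u_i, …, u_i(uₙ+τₙ))`. The dictionary
(`tr_dv_bl_eq_coeff_chartMap`) says, with NO hypothesis on `g`:

  `tr i τ s (dv i s (bl i g)) B = coeff (B + s·e_i) (chartMap i τ f)`,

i.e. the route's formulas compute exactly the coefficients of `σ_{i,τ}(f) / u_i^s`. Ingredients:
the coefficients of `σ_{i,τ}` on monomials (`coeff_prod_chartSubst_pow`, a multinomial/binomial
count done in `MvPolynomial` via `Literature.AlgebraicGeometry.Resolution.CobordantChart.coeff_prod_C_add_X_pow`), Mathlib's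
`MvPowerSeries.coeff_subst`, and a re-indexing of the route's truncated Taylor sum.

Helper namespace `…Theorems.FrobeniusClosing.TransportProof` (lead's tag).
-/

noncomputable section

-- single-problem summit: the doubled namespace component `ResolutionOfSingularities` is forced
set_option linter.dupNamespace false

open scoped BigOperators Classical
open MvPowerSeries

namespace Summit.ResolutionOfSingularities.ResolutionOfSingularities.Theorems.FrobeniusClosing

open FactorizationProof

namespace TransportProof

variable {n : ℕ} {K : Type} [Field K]

/-- The chart substitution as polynomials: `X i` resp. `X i * (X j + C (τ j))`. [folklore] -/
theorem chartSubst_eq_coe (i : Fin n) (τ : Fin n → K) (j : Fin n) :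
    chartSubst n K i τ j =
      ((if j = i then MvPolynomial.X i
        else MvPolynomial.X i * (MvPolynomial.X j + MvPolynomial.C (τ j)) : MvPolynomial (Fin n) K) :
        MvPowerSeries (Fin n) K) := by
  unfold chartSubst
  split_ifs <;> simp [MvPolynomial.coe_mul, MvPolynomial.coe_add, MvPolynomial.coe_X, MvPolynomial.coe_C]

/-- **Coefficients of the chart substitution on monomials.** For an exponent `A`,
`coeff B (∏ j, σ_{i,τ}(u_j) ^ A j) = [ |A| = B i ] · ∏_{j ≠ i} C(A j, B j) τ_j ^ (A j - B j)`.
[folklore] -/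
theorem coeff_prod_chartSubst_pow (i : Fin n) (τ : Fin n → K) (A B : Fin n →₀ ℕ) :
    coeff B (∏ j, chartSubst n K i τ j ^ A j) =
      if (Finset.univ.sum fun j => A j) = B i then
        (Finset.univ.erase i).prod fun j => ((Nat.choose (A j) (B j) : ℕ) : K) * τ j ^ (A j - B j)
      else 0 := by
  set N : ℕ := Finset.univ.sum fun j => A j with hN
  set d' : Fin n → ℕ := Function.update (⇑A) i 0 with hd'
  set Qp : MvPolynomial (Fin n) K := ∏ j, (MvPolynomial.C (τ j) + MvPolynomial.X j) ^ d' j with hQp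
  -- the product of the substituted variables is `X i ^ |A|` times a polynomial in the other variables
  have hprod : (∏ j, chartSubst n K i τ j ^ A j) = X i ^ N * (Qp : MvPowerSeries (Fin n) K) := by
    have hi : chartSubst n K i τ i = X i := by simp [chartSubst]
    have hj : ∀ j ∈ Finset.univ.erase i, chartSubst n K i τ j ^ A j =
        X i ^ A j * (((MvPolynomial.C (τ j) + MvPolynomial.X j : MvPolynomial (Fin n) K) :
          MvPowerSeries (Fin n) K)) ^ d' j := by
      intro j hj
      have hji : j ≠ i := Finset.ne_of_mem_erase hj
      simp only [chartSubst, if_neg hji, hd', Function.update_of_ne hji, MvPolynomial.coe_add,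
        MvPolynomial.coe_C, MvPolynomial.coe_X, ← mul_pow]
      ring
    have hQ : (Qp : MvPowerSeries (Fin n) K) =
        ∏ j ∈ Finset.univ.erase i, (((MvPolynomial.C (τ j) + MvPolynomial.X j : MvPolynomial (Fin n) K) :
          MvPowerSeries (Fin n) K)) ^ d' j := by
      rw [hQp, ← MvPolynomial.coeToMvPowerSeries.ringHom_apply, map_prod,
        ← Finset.mul_prod_erase _ _ (Finset.mem_univ i)]
      simp only [map_pow, MvPolynomial.coeToMvPowerSeries.ringHom_apply, hd', Function.update_self,
        pow_zero, MvPolynomial.coe_one, one_mul]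
    rw [← Finset.mul_prod_erase _ _ (Finset.mem_univ i), Finset.prod_congr rfl hj, Finset.prod_mul_distrib,
      Finset.prod_pow_eq_pow_sum, hi, ← mul_assoc, ← pow_add, Finset.add_sum_erase _ _ (Finset.mem_univ i),
      hQ]
  rw [hprod, X_pow_eq, coeff_monomial_mul]
  by_cases hle : Finsupp.single i N ≤ B
  · have hNle : N ≤ B i := by simpa using hle i
    rw [if_pos hle, one_mul, MvPolynomial.coeff_coe, hQp, Literature.AlgebraicGeometry.Resolution.CobordantChart.coeff_prod_C_add_X_pow,
      ← Finset.mul_prod_erase _ _ (Finset.mem_univ i)]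
    have hBi : (B - Finsupp.single i N) i = B i - N := by simp
    have hBj : ∀ j ∈ Finset.univ.erase i, (B - Finsupp.single i N) j = B j := by
      intro j hj
      simp [Finsupp.single_eq_of_ne (Finset.ne_of_mem_erase hj)]
    simp only [hd', Function.update_self, hBi, Nat.zero_sub, pow_zero, mul_one]
    by_cases hEq : N = B i
    · have h0 : B i - N = 0 := by omega
      rw [if_pos hEq, h0, Nat.choose_zero_right, Nat.cast_one, one_mul]
      refine Finset.prod_congr rfl fun j hj => ?_
      rw [Function.update_of_ne (Finset.ne_of_mem_erase hj), hBj j hj]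
    · rw [if_neg hEq]
      have hpos : 0 < B i - N := by omega
      obtain ⟨k, hk⟩ := Nat.exists_eq_succ_of_ne_zero hpos.ne'
      rw [hk, Nat.choose_zero_succ, Nat.cast_zero, zero_mul]
  · rw [if_neg hle, if_neg]
    intro hEq
    apply hle
    intro j
    by_cases hji : j = i
    · subst hji; simp [hEq]
    · simp [Finsupp.single_eq_of_ne hji]

/-- **Coefficients of the chart substitution.** `coeff B (σ_{i,τ} f)` is the finite sum, over the
exponents `A` of total degree `B i`, of `coeff A f · ∏_{j ≠ i} C(A j, B j) τ_j^(A j - B j)`. [folklore] -/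
theorem coeff_chartMap (i : Fin n) (τ : Fin n → K) (f : MvPowerSeries (Fin n) K) (B : Fin n →₀ ℕ) :
    coeff B (chartMap n K i τ f) =
      ((Finset.univ : Finset (Fin n)).finsuppAntidiag (B i)).sum fun A =>
        coeff A f * (Finset.univ.erase i).prod fun j => ((Nat.choose (A j) (B j) : ℕ) : K) * τ j ^ (A j - B j) := by
  unfold chartMap
  rw [coeff_subst (hasSubst_chartSubst i τ)]
  have hterm : ∀ A : Fin n →₀ ℕ, coeff A f • coeff B (A.prod fun j e => chartSubst n K i τ j ^ e) =
      if (Finset.univ.sum fun j => A j) = B i then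
        coeff A f * (Finset.univ.erase i).prod fun j => ((Nat.choose (A j) (B j) : ℕ) : K) * τ j ^ (A j - B j)
      else 0 := by
    intro A
    rw [Finsupp.prod_pow, coeff_prod_chartSubst_pow, smul_eq_mul]
    split_ifs <;> simp
  simp_rw [hterm]
  rw [finsum_eq_sum_of_support_subset _ (s := (Finset.univ : Finset (Fin n)).finsuppAntidiag (B i))]
  · refine Finset.sum_congr rfl fun A hA => ?_
    rw [Finset.mem_finsuppAntidiag] at hA
    rw [if_pos hA.1]
  · intro A hA
    rw [Function.mem_support] at hA
    rw [Finset.mem_coe, Finset.mem_finsuppAntidiag]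
    refine ⟨?_, by simp⟩
    by_contra h
    exact hA (if_neg h)

/-- `dv i s ∘ bl i` read at `B + D` (`D i = 0`): the blow-up chart shifts the `i`-th exponent. [folklore] -/
theorem dv_bl_apply (g : (Fin n → ℕ) → K) (i : Fin n) (s : ℕ) (B D : Fin n → ℕ) (hD : D i = 0) :
    dv n K i s (bl n K i g) (B + D) =
      if (Finset.univ.erase i).sum (fun j => B j + D j) ≤ B i + s then
        g (Function.update (B + D) i (B i + s - (Finset.univ.erase i).sum (fun j => B j + D j)))
      else 0 := by
  unfold dv bl
  have hsum : (Finset.univ.erase i).sum (fun j => Function.update (B + D) i ((B + D) i + s) j) =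
      (Finset.univ.erase i).sum (fun j => B j + D j) :=
    Finset.sum_congr rfl fun j hj => by rw [Function.update_of_ne (Finset.ne_of_mem_erase hj)]; rfl
  have hi : Function.update (B + D) i ((B + D) i + s) i = B i + s := by
    rw [Function.update_self, Pi.add_apply, hD, add_zero]
  simp only [hsum, hi, Function.update_idem]

/-- **THE DICTIONARY.** The route's "blow up, chart `i`, divide by `u_i ^ s`, translate to `τ`" computes
the coefficients of `σ_{i,τ}(f) / u_i ^ s`: for every coefficient function `g`, every `s` and `B`,
`tr i τ s (dv i s (bl i g)) B = coeff (B + s·e_i) (chartMap i τ f)` where `g` is the coefficient function of `f`.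
[folklore] -/
theorem tr_dv_bl_eq_coeff_chartMap (f : MvPowerSeries (Fin n) K) (i : Fin n) (τ : Fin n → K) (s : ℕ)
    (B : Fin n → ℕ) :
    tr n K i τ s (dv n K i s (bl n K i (fun A => coeff (Finsupp.equivFunOnFinite.symm A) f))) B =
      coeff (Finsupp.equivFunOnFinite.symm (Function.update B i (B i + s))) (chartMap n K i τ f) := by
  set g : (Fin n → ℕ) → K := fun A => coeff (Finsupp.equivFunOnFinite.symm A) f with hg
  have coeff_ofCoeffs : ∀ A : Fin n →₀ ℕ, coeff A f = g ⇑A := fun A => by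
    simp only [hg, Finsupp.equivFunOnFinite_symm_coe]
  rw [coeff_chartMap]
  unfold tr
  -- abbreviations
  set B' : Fin n → ℕ := Function.update B i (B i + s) with hB'
  have hB'i : B' i = B i + s := by rw [hB', Function.update_self]
  have hB'j : ∀ j, j ≠ i → B' j = B j := fun j hj => by rw [hB', Function.update_of_ne hj]
  have heB' : ∀ j, (Finsupp.equivFunOnFinite.symm B') j = B' j := fun j => rfl
  set PF := Fintype.piFinset (fun _ : Fin n => Finset.range (B i + s + 1)) with hPF
  set cond : (Fin n → ℕ) → Prop := fun D => (Finset.univ.erase i).sum (fun j => B j + D j) ≤ B i + s with hcond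
  set Aof : (Fin n → ℕ) → (Fin n →₀ ℕ) := fun D =>
    Finsupp.equivFunOnFinite.symm (Function.update (B + D) i (B i + s - (Finset.univ.erase i).sum (fun j => B j + D j)))
    with hAof
  set Dof : (Fin n →₀ ℕ) → (Fin n → ℕ) := fun A => Function.update (fun j => A j - B j) i 0 with hDof
  -- Step 1: the route's sum, restricted to the `D` that contribute
  have hL : PF.sum (fun D => @ite K (D i = 0) (Classical.dec _)
        (dv n K i s (bl n K i g) (B + D) *
          (Finset.univ.erase i).prod (fun j => ((Nat.choose (B j + D j) (B j) : ℕ) : K) * τ j ^ (D j))) 0) =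
      (PF.filter fun D => D i = 0 ∧ cond D).sum (fun D => g ⇑(Aof D) *
          (Finset.univ.erase i).prod (fun j => ((Nat.choose (B j + D j) (B j) : ℕ) : K) * τ j ^ (D j))) := by
    rw [Finset.sum_filter]
    refine Finset.sum_congr rfl fun D _ => ?_
    by_cases hDi : D i = 0
    · rw [if_pos hDi, dv_bl_apply g i s B D hDi]
      by_cases hc : cond D
      · rw [if_pos hc, if_pos ⟨hDi, hc⟩]
        rfl
      · rw [if_neg hc, zero_mul, if_neg (fun h => hc h.2)]
    · rw [if_neg hDi, if_neg (fun h => hDi h.1)]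
  -- Step 2: the substitution's sum, restricted to the `A` that contribute
  have hR : ((Finset.univ : Finset (Fin n)).finsuppAntidiag ((Finsupp.equivFunOnFinite.symm B') i)).sum
        (fun A => coeff A f *
          (Finset.univ.erase i).prod (fun j => ((Nat.choose (A j) ((Finsupp.equivFunOnFinite.symm B') j) : ℕ) : K) *
            τ j ^ (A j - (Finsupp.equivFunOnFinite.symm B') j))) =
      (((Finset.univ : Finset (Fin n)).finsuppAntidiag (B i + s)).filter fun A => ∀ j, j ≠ i → B j ≤ A j).sum
        (fun A => g ⇑A * (Finset.univ.erase i).prod (fun j => ((Nat.choose (A j) (B j) : ℕ) : K) * τ j ^ (A j - B j))) := by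
    simp only [heB', hB'i]
    rw [Finset.sum_filter]
    refine Finset.sum_congr rfl fun A _ => ?_
    have hprod : (Finset.univ.erase i).prod (fun j => ((Nat.choose (A j) (B' j) : ℕ) : K) * τ j ^ (A j - B' j)) =
        (Finset.univ.erase i).prod (fun j => ((Nat.choose (A j) (B j) : ℕ) : K) * τ j ^ (A j - B j)) :=
      Finset.prod_congr rfl fun j hj => by rw [hB'j j (Finset.ne_of_mem_erase hj)]
    rw [hprod, coeff_ofCoeffs]
    split_ifs with hA
    · rfl
    · push Not at hA
      obtain ⟨j, hji, hlt⟩ := hA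
      rw [Finset.prod_eq_zero (Finset.mem_erase.2 ⟨hji, Finset.mem_univ j⟩), mul_zero]
      rw [Nat.choose_eq_zero_of_lt hlt, Nat.cast_zero, zero_mul]
  rw [hL, hR]
  -- Step 3: the bijection `D ↦ A`
  refine Finset.sum_nbij' Aof Dof ?_ ?_ ?_ ?_ ?_
  · -- `Aof` maps into the target set
    intro D hD
    rw [Finset.mem_filter] at hD ⊢
    obtain ⟨-, hDi, hc⟩ := hD
    refine ⟨?_, ?_⟩
    · rw [Finset.mem_finsuppAntidiag]
      refine ⟨?_, by simp⟩
      rw [← Finset.add_sum_erase _ _ (Finset.mem_univ i)]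
      simp only [hAof, Finsupp.coe_equivFunOnFinite_symm, Function.update_self]
      rw [Finset.sum_congr rfl (fun j hj => Function.update_of_ne (Finset.ne_of_mem_erase hj) _ _)]
      simp only [Pi.add_apply]
      omega
    · intro j hji
      simp only [hAof, Finsupp.coe_equivFunOnFinite_symm, Function.update_of_ne hji, Pi.add_apply]
      omega
  · -- `Dof` maps into the source set
    intro A hA
    rw [Finset.mem_filter] at hA ⊢
    obtain ⟨hA, hle⟩ := hA
    rw [Finset.mem_finsuppAntidiag] at hA
    have hsumA : (Finset.univ.sum fun j => A j) = B i + s := hA.1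
    have hAj_le : ∀ j, A j ≤ B i + s := fun j => by
      rw [← hsumA]; exact Finset.single_le_sum (fun _ _ => Nat.zero_le _) (Finset.mem_univ j)
    refine ⟨?_, ?_, ?_⟩
    · rw [hPF, Fintype.mem_piFinset]
      intro j
      rw [Finset.mem_range]
      by_cases hji : j = i
      · subst hji; simp [hDof]
      · simp only [hDof, Function.update_of_ne hji]
        have := hAj_le j
        omega
    · simp [hDof]
    · show (Finset.univ.erase i).sum (fun j => B j + Dof A j) ≤ B i + s
      rw [← hsumA, ← Finset.add_sum_erase _ _ (Finset.mem_univ i)]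
      have : (Finset.univ.erase i).sum (fun j => B j + Dof A j) = (Finset.univ.erase i).sum (fun j => A j) :=
        Finset.sum_congr rfl fun j hj => by
          have hji := Finset.ne_of_mem_erase hj
          simp only [hDof, Function.update_of_ne hji]
          have := hle j hji
          omega
      rw [this]
      omega
  · -- `Dof ∘ Aof = id` on the source
    intro D hD
    rw [Finset.mem_filter] at hD
    obtain ⟨-, hDi, -⟩ := hD
    funext j
    by_cases hji : j = i
    · subst hji; simp [hDof, hDi]
    · simp only [hDof, hAof, Function.update_of_ne hji, Finsupp.coe_equivFunOnFinite_symm, Pi.add_apply]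
      omega
  · -- `Aof ∘ Dof = id` on the target
    intro A hA
    rw [Finset.mem_filter] at hA
    obtain ⟨hA, hle⟩ := hA
    rw [Finset.mem_finsuppAntidiag] at hA
    have hsumA : (Finset.univ.sum fun j => A j) = B i + s := hA.1
    ext j
    by_cases hji : j = i
    · subst hji
      simp only [hAof, Finsupp.coe_equivFunOnFinite_symm, Function.update_self]
      have : (Finset.univ.erase j).sum (fun k => B k + Dof A k) = (Finset.univ.erase j).sum (fun k => A k) :=
        Finset.sum_congr rfl fun k hk => by
          have hkj := Finset.ne_of_mem_erase hk
          simp only [hDof, Function.update_of_ne hkj]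
          have := hle k hkj
          omega
      rw [this, ← hsumA, ← Finset.add_sum_erase _ _ (Finset.mem_univ j)]
      omega
    · simp only [hAof, Finsupp.coe_equivFunOnFinite_symm, Function.update_of_ne hji, Pi.add_apply, hDof]
      have := hle j hji
      omega
  · -- the summands agree
    intro D hD
    rw [Finset.mem_filter] at hD
    obtain ⟨-, hDi, -⟩ := hD
    congr 1
    refine Finset.prod_congr rfl fun j hj => ?_
    have hji := Finset.ne_of_mem_erase hj
    simp only [hAof, Finsupp.coe_equivFunOnFinite_symm, Function.update_of_ne hji, Pi.add_apply,
      Nat.add_sub_cancel_left]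

end TransportProof

/-- **Transport dictionary (anchor of this file).** The route's move read on the cleaned series:
`tr i τ s (dv i s (bl i (clean c))) B = coeff (B + s·e_i) (σ_{i,τ} (ser c))`. [folklore] -/
theorem transport_dictionary {n : ℕ} {K : Type} [Field K] (p : ℕ) (c : (Fin n → ℕ) → K) (i : Fin n)
    (τ : Fin n → K) (s : ℕ) (B : Fin n → ℕ) :
    tr n K i τ s (dv n K i s (bl n K i (clean p n K c))) B =
      MvPowerSeries.coeff (Finsupp.equivFunOnFinite.symm (Function.update B i (B i + s)))
        (chartMap n K i τ (ser p n K c)) :=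
  TransportProof.tr_dv_bl_eq_coeff_chartMap (ser p n K c) i τ s B

end Summit.ResolutionOfSingularities.ResolutionOfSingularities.Theorems.FrobeniusClosing

end
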